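import Summits.QuantumFields.YangMills.Theorems.RenyiTelescopeArithClosure

/-!
# Route `RenyiTelescope` — re-glue item `HistoryTailOfRenyiTelescopeR` (stmt-QuantumFields-27545): THE ARITHMETIC CLOSURE
# for the REPAIRED crux `CutoffRenyiLR` (support file; registered stub `stub_arithClosureR` of the re-glue skeleton v8)

Pure real analysis, no measures.  After the repair `CutoffRenyiL → CutoffRenyiLR` (stmt-QuantumFields-27544: one-step exponent
`R₀(q−1)p⁴L^(3F.m)(γ²/L^(2J) + 1/L^(4J))`, orders `1 < q ≤ Q·L^J`) the telescope of the glue runs with the GEOMETRIC ORDERS `q_J = κ(3/2)^J`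
(ratio `3/2 ≤ L`), so the instantiation (`Theorems/RenyiTelescopeGlueRestR.lean`) needs, for every family `F`, coupling `0 < γ ≤ 1`, profile
`b₀ > 0, p₀ > 0` and constants `η, κ > 0`, fine-regime cut-offs `J₀(d) ≥ 1` such that for all depths `d ≥ h₀`:
`γ_d·L^(J₀(d))·p(g_d)² ≤ η` (the fine regime of crux `FineRegimeUnitTailL` reaches `J₀(d)`; `γ_d = γL^(−d)`), `κ(3/2)^(J₀(d)) ≥ 6` (order budget
`Σ_(J ≥ J₀) 1/q_J ≤ 3/(κ(3/2)^(J₀)) ≤ 1/2`) and `p(g_d)⁴·L^(3(m+d))·(γ_d²(3/2)^(J₀)/L^(2J₀) + (3/2)^(J₀)/L^(4J₀)) ≤ 1` (the telescope's summed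
exponent is `≤ (4/3)R₀κ`).  We take `J₀(d) = d − ⌊d/8⌋` as before: with `t = ⌊d/8⌋`, `s = J₀(d)` (`7t ≤ s ≤ 7t + 7`, `s + t = d`) both exponent
terms are `≤ p(g_d)⁴·L^(3m)·(3/2)^(7t+7)·L^(4t)`-controlled (`(3/2)^s ≤ (3/2)^(7t+7)`, `L^(3d) ≤ L^(4s−4t)`, `γ²L^d ≤ L^(2s−4t)`), and
`2(3/2)^7β⁴L^(3m)(t+1)^(4N) ≤ (L⁴/(3/2)^7)^t` eventually (`exists_poly_le_pow`; `L ≥ 3` so `L⁴ ≥ 81 > (3/2)^7`), where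
`p(g_d) ≤ β(t+1)^N` is the polynomial envelope of the template file (`N = ⌈p₀⌉`, `β = b₀(8α)^(p₀)`, `α = 1 + ½log L − ½log γ`).

WHAT THIS IS NOT: no Gibbs measure appears; nothing here bears on the cruxes, the rung R3 or the mass gap; `YM3TorusSU2` is NOT proved.

References: T. Bałaban, CMP 102 (1985) 255–275 [Balaban1985UV3] ((7) p.257: the thresholds `p(g) = b₀(1 + log g⁻¹)^(p₀)`).
-/

noncomputable section

open Filter
open Literature.MathematicalPhysics.QuantumFieldTheory.Balaban1983to89
open Literature.MathematicalPhysics.QuantumFieldTheory.Balaban1983to89.T3ContinuumYM3Torus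
open Summit.QuantumFields.YangMills.Theorems.LargeFieldMassRefinementTailElementaryEnvelope

namespace Summit.QuantumFields.YangMills.Theorems.RenyiTelescope

/-- The ratio base of the repaired telescope: `(3/2)^7 < L^4` for `L ≥ 3` (`(3/2)^7 = 2187/128 < 81`). [folklore] -/
theorem threeHalves_pow_seven_lt_pow_four {L : ℝ} (hL : 3 ≤ L) : (3 / 2 : ℝ) ^ 7 < L ^ 4 := by
  have h81 : (3 : ℝ) ^ 4 ≤ L ^ 4 := pow_le_pow_left₀ (by norm_num) hL 4
  have h : (3 / 2 : ℝ) ^ 7 < (3 : ℝ) ^ 4 := by norm_num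
  exact h.trans_le h81

/-- **THE POLYNOMIAL ENVELOPE OF THE THRESHOLD PROFILE ALONG REFINEMENT**: with `α = 1 + ½log L − ½log γ` and `N = ⌈p₀⌉`,
`p(g_d) ≤ b₀(8α)^(p₀)·(⌊d/8⌋ + 1)^N` for every depth `d` (`0 < γ ≤ 1`, `b₀, p₀ > 0`). [cite: Balaban1985UV3, (7) p.257] -/
theorem pFun_coupling_le_envelope (F : T3Family) {γ b₀ p₀ : ℝ} (hγ : 0 < γ) (hγ1 : γ ≤ 1) (hb₀ : 0 < b₀) (hp₀ : 0 < p₀) (d : ℕ) :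
    B10.pFun b₀ p₀ (Real.sqrt (γ * ((F.L : ℝ)⁻¹) ^ d)) ≤
      b₀ * (8 * (1 + Real.log F.L / 2 - Real.log γ / 2)) ^ p₀ * (((d / 8 : ℕ) : ℝ) + 1) ^ ⌈p₀⌉₊ := by
  have hL1 : (1 : ℝ) < F.L := by exact_mod_cast F.hL.2
  have hℓ0 : 0 < Real.log F.L := Real.log_pos hL1
  have hlogγ : Real.log γ ≤ 0 := Real.log_nonpos hγ.le hγ1
  set α : ℝ := 1 + Real.log F.L / 2 - Real.log γ / 2 with hα
  have hα1 : 1 ≤ α := by rw [hα]; linarith [hℓ0.le]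
  rw [pFun_coupling_eq F hγ b₀ p₀ d]
  have hd8 : (d : ℝ) + 1 ≤ 8 * (((d / 8 : ℕ) : ℝ) + 1) := by
    have h : d + 1 ≤ 8 * (d / 8 + 1) := by omega
    have h' : ((d + 1 : ℕ) : ℝ) ≤ ((8 * (d / 8 + 1) : ℕ) : ℝ) := by exact_mod_cast h
    push_cast at h'
    linarith
  have hu0 : 0 ≤ 1 + ((d : ℝ) * Real.log F.L - Real.log γ) / 2 := by
    have : 0 ≤ (d : ℝ) * Real.log F.L := by positivity
    linarith
  have hule : 1 + ((d : ℝ) * Real.log F.L - Real.log γ) / 2 ≤ (8 * α) * (((d / 8 : ℕ) : ℝ) + 1) := by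
    have h1 : 1 + ((d : ℝ) * Real.log F.L - Real.log γ) / 2 ≤ α * ((d : ℝ) + 1) := by
      rw [hα]
      nlinarith [mul_nonneg (neg_nonneg.mpr hlogγ) (Nat.cast_nonneg d : (0 : ℝ) ≤ d), (Nat.cast_nonneg d : (0 : ℝ) ≤ d),
        mul_nonneg hℓ0.le (Nat.cast_nonneg d : (0 : ℝ) ≤ d)]
    calc 1 + ((d : ℝ) * Real.log F.L - Real.log γ) / 2 ≤ α * ((d : ℝ) + 1) := h1
      _ ≤ α * (8 * (((d / 8 : ℕ) : ℝ) + 1)) := mul_le_mul_of_nonneg_left hd8 (by linarith)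
      _ = (8 * α) * (((d / 8 : ℕ) : ℝ) + 1) := by ring
  have ht1 : (1 : ℝ) ≤ ((d / 8 : ℕ) : ℝ) + 1 := by
    have : (0 : ℝ) ≤ ((d / 8 : ℕ) : ℝ) := Nat.cast_nonneg _
    linarith
  have hβ0 : 0 < b₀ * (8 * α) ^ p₀ := by positivity
  calc b₀ * (1 + ((d : ℝ) * Real.log F.L - Real.log γ) / 2) ^ p₀ ≤ b₀ * ((8 * α) * (((d / 8 : ℕ) : ℝ) + 1)) ^ p₀ :=
        mul_le_mul_of_nonneg_left (Real.rpow_le_rpow hu0 hule hp₀.le) hb₀.le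
    _ = b₀ * (8 * α) ^ p₀ * (((d / 8 : ℕ) : ℝ) + 1) ^ p₀ := by
        rw [Real.mul_rpow (by positivity) (by positivity)]
        ring
    _ ≤ b₀ * (8 * α) ^ p₀ * (((d / 8 : ℕ) : ℝ) + 1) ^ ((⌈p₀⌉₊ : ℕ) : ℝ) :=
        mul_le_mul_of_nonneg_left (Real.rpow_le_rpow_of_exponent_le ht1 (Nat.le_ceil p₀)) hβ0.le
    _ = b₀ * (8 * α) ^ p₀ * (((d / 8 : ℕ) : ℝ) + 1) ^ ⌈p₀⌉₊ := by rw [Real.rpow_natCast]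

/-- **REGISTERED STUB `stub_arithClosureR` OF THE RE-GLUE SKELETON v8 (item stmt-QuantumFields-27545)** — the arithmetic closure of the
instantiation for the repaired crux `CutoffRenyiLR`: fine-regime cut-offs `J₀(d) = d − ⌊d/8⌋`, geometric orders `κ(3/2)^J`.
[cite: Balaban1985UV3, (7) p.257] -/
theorem stub_arithClosureR :
    ∀ (F : T3Family) (γ b₀ p₀ η κ : ℝ), 0 < γ → γ ≤ 1 → 0 < b₀ → 0 < p₀ → 0 < η → 0 < κ → ∃ (h₀ : ℕ) (J₀ : ℕ → ℕ), ∀ d, h₀ ≤ d →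
      1 ≤ J₀ d ∧
      γ * ((F.L : ℝ)⁻¹) ^ d * (F.L : ℝ) ^ (J₀ d) * (B10.pFun b₀ p₀ (Real.sqrt (γ * ((F.L : ℝ)⁻¹) ^ d))) ^ 2 ≤ η ∧
      6 ≤ κ * (3 / 2 : ℝ) ^ (J₀ d) ∧
      (B10.pFun b₀ p₀ (Real.sqrt (γ * ((F.L : ℝ)⁻¹) ^ d))) ^ 4 * (F.L : ℝ) ^ (3 * (F.m + d)) *
        ((γ * ((F.L : ℝ)⁻¹) ^ d) ^ 2 * (3 / 2 : ℝ) ^ (J₀ d) / (F.L : ℝ) ^ (2 * J₀ d) + (3 / 2 : ℝ) ^ (J₀ d) / (F.L : ℝ) ^ (4 * J₀ d)) ≤ 1 := by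
  intro F γ b₀ p₀ η κ hγ hγ1 hb₀ hp₀ hη hκ
  have hL1 : (1 : ℝ) < F.L := by exact_mod_cast F.hL.2
  have hL0 : (0 : ℝ) < F.L := one_pos.trans hL1
  have hL3 : (3 : ℝ) ≤ F.L := by
    have h2 : 2 ≤ F.L := F.hL.2
    have h3 : 3 ≤ F.L := by
      rcases F.hL.1 with ⟨k, hk⟩
      omega
    exact_mod_cast h3
  -- the polynomial envelope of `p(g_d)`
  set β : ℝ := b₀ * (8 * (1 + Real.log F.L / 2 - Real.log γ / 2)) ^ p₀ with hβ
  set N : ℕ := ⌈p₀⌉₊ with hN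
  have hβ0 : 0 < β := by
    have hℓ0 : 0 < Real.log F.L := Real.log_pos hL1
    have hlogγ : Real.log γ ≤ 0 := Real.log_nonpos hγ.le hγ1
    have hα : 0 < 1 + Real.log F.L / 2 - Real.log γ / 2 := by linarith
    positivity
  have hp_le : ∀ d : ℕ, B10.pFun b₀ p₀ (Real.sqrt (γ * ((F.L : ℝ)⁻¹) ^ d)) ≤ β * (((d / 8 : ℕ) : ℝ) + 1) ^ N :=
    fun d => pFun_coupling_le_envelope F hγ hγ1 hb₀ hp₀ d
  -- the ratio of the exponent budget: `r = L⁴/(3/2)^7 > 1`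
  have h32 : (0 : ℝ) < (3 / 2 : ℝ) ^ 7 := by positivity
  set r : ℝ := (F.L : ℝ) ^ 4 / (3 / 2 : ℝ) ^ 7 with hr
  have hr1 : 1 < r := by
    rw [hr, lt_div_iff₀ h32, one_mul]
    exact threeHalves_pow_seven_lt_pow_four hL3
  -- the three eventual conditions in `t = ⌊d/8⌋`
  obtain ⟨t₂, ht₂⟩ := exists_poly_le_pow (γ * β ^ 2 / η) (2 * N) hL1
  obtain ⟨t₃, ht₃⟩ := exists_poly_le_pow (6 / κ) 0 (by norm_num : (1 : ℝ) < 3 / 2)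
  obtain ⟨t₄, ht₄⟩ := exists_poly_le_pow (2 * (3 / 2 : ℝ) ^ 7 * β ^ 4 * (F.L : ℝ) ^ (3 * F.m)) (4 * N) hr1
  refine ⟨8 * max t₂ (max t₃ t₄) + 8, fun d => d - d / 8, fun d hd => ?_⟩
  have hT : max t₂ (max t₃ t₄) ≤ d / 8 := by omega
  have ht₂d : t₂ ≤ d / 8 := (le_max_left _ _).trans hT
  have ht₃d : t₃ ≤ d / 8 := ((le_max_left _ _).trans (le_max_right _ _)).trans hT
  have ht₄d : t₄ ≤ d / 8 := ((le_max_right _ _).trans (le_max_right _ _)).trans hT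
  set p : ℝ := B10.pFun b₀ p₀ (Real.sqrt (γ * ((F.L : ℝ)⁻¹) ^ d)) with hp
  have hg0 : 0 < γ * ((F.L : ℝ)⁻¹) ^ d := by positivity
  have hg1 : γ * ((F.L : ℝ)⁻¹) ^ d ≤ 1 :=
    mul_le_one₀ hγ1 (by positivity) (pow_le_one₀ (by positivity) (inv_le_one_of_one_le₀ hL1.le))
  have hp0 : 0 ≤ p :=
    B10.pFun_nonneg b₀ p₀ _ hb₀.le (Real.sqrt_pos.mpr hg0) ((Real.sqrt_le_sqrt hg1).trans_eq Real.sqrt_one)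
  have hpN : p ≤ β * (((d / 8 : ℕ) : ℝ) + 1) ^ N := hp_le d
  have hLt : 0 < (F.L : ℝ) ^ (d / 8) := by positivity
  -- bookkeeping of `s = d − t`, `t = ⌊d/8⌋`
  have hts : d / 8 ≤ d - d / 8 := by omega
  have hs7 : d - d / 8 ≤ 7 * (d / 8) + 7 := by omega
  have h7s : 7 * (d / 8) ≤ d - d / 8 := by omega
  refine ⟨Nat.le_sub_of_add_le (by omega), ?_, ?_, ?_⟩
  · -- the fine regime reaches `J₀(d)`: `γ·p²/L^t ≤ η`
    have hsplit : (F.L : ℝ) ^ d = (F.L : ℝ) ^ (d - d / 8) * (F.L : ℝ) ^ (d / 8) := by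
      rw [← pow_add, Nat.sub_add_cancel (Nat.div_le_self d 8)]
    have e : ((F.L : ℝ)⁻¹) ^ d * (F.L : ℝ) ^ (d - d / 8) = ((F.L : ℝ) ^ (d / 8))⁻¹ := by
      rw [inv_pow, hsplit]
      field_simp
    have h2 := ht₂ (d / 8) ht₂d
    calc γ * ((F.L : ℝ)⁻¹) ^ d * (F.L : ℝ) ^ (d - d / 8) * p ^ 2 = γ * p ^ 2 * ((F.L : ℝ) ^ (d / 8))⁻¹ := by
          rw [mul_assoc γ, e]
          ring
      _ ≤ γ * (β * (((d / 8 : ℕ) : ℝ) + 1) ^ N) ^ 2 * ((F.L : ℝ) ^ (d / 8))⁻¹ := by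
          gcongr
      _ = (γ * β ^ 2 / η * (((d / 8 : ℕ) : ℝ) + 1) ^ (2 * N)) * (η * ((F.L : ℝ) ^ (d / 8))⁻¹) := by
          rw [pow_mul', mul_pow]
          field_simp
      _ ≤ (F.L : ℝ) ^ (d / 8) * (η * ((F.L : ℝ) ^ (d / 8))⁻¹) := mul_le_mul_of_nonneg_right h2 (by positivity)
      _ = η := by field_simp
  · -- the telescope's orders close their budget: `6 ≤ κ(3/2)^t ≤ κ(3/2)^(J₀(d))`
    have h3 := ht₃ (d / 8) ht₃d
    rw [pow_zero, mul_one, div_le_iff₀ hκ] at h3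
    calc (6 : ℝ) ≤ (3 / 2 : ℝ) ^ (d / 8) * κ := h3
      _ ≤ (3 / 2 : ℝ) ^ (d - d / 8) * κ :=
          mul_le_mul_of_nonneg_right (pow_le_pow_right₀ (by norm_num) hts) hκ.le
      _ = κ * (3 / 2 : ℝ) ^ (d - d / 8) := mul_comm _ _
  · -- the telescope's exponent: both terms `≤ 1/2`
    have h4 := ht₄ (d / 8) ht₄d
    -- `r^t = L^(4t)/(3/2)^(7t)`
    have hrt : r ^ (d / 8) = (F.L : ℝ) ^ (4 * (d / 8)) / (3 / 2 : ℝ) ^ (7 * (d / 8)) := by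
      rw [hr, div_pow, ← pow_mul, ← pow_mul, mul_comm 4, mul_comm 7]
    -- the key: `2·(3/2)^(7t+7)·p⁴·L^(3m) ≤ L^(4t)`
    have hp4 : p ^ 4 ≤ β ^ 4 * (((d / 8 : ℕ) : ℝ) + 1) ^ (4 * N) := by
      calc p ^ 4 ≤ (β * (((d / 8 : ℕ) : ℝ) + 1) ^ N) ^ 4 := pow_le_pow_left₀ hp0 hpN 4
        _ = β ^ 4 * (((d / 8 : ℕ) : ℝ) + 1) ^ (4 * N) := by rw [mul_pow, ← pow_mul, mul_comm N 4]
    have hkey : 2 * (3 / 2 : ℝ) ^ (7 * (d / 8) + 7) * p ^ 4 * (F.L : ℝ) ^ (3 * F.m) ≤ (F.L : ℝ) ^ (4 * (d / 8)) := by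
      have h37 : (0 : ℝ) < (3 / 2 : ℝ) ^ (7 * (d / 8)) := by positivity
      have h4' : 2 * (3 / 2 : ℝ) ^ 7 * β ^ 4 * (F.L : ℝ) ^ (3 * F.m) * (((d / 8 : ℕ) : ℝ) + 1) ^ (4 * N) * (3 / 2 : ℝ) ^ (7 * (d / 8)) ≤
          (F.L : ℝ) ^ (4 * (d / 8)) := by
        rw [hrt, le_div_iff₀ h37] at h4
        exact h4
      calc 2 * (3 / 2 : ℝ) ^ (7 * (d / 8) + 7) * p ^ 4 * (F.L : ℝ) ^ (3 * F.m)
          = 2 * (3 / 2 : ℝ) ^ 7 * (F.L : ℝ) ^ (3 * F.m) * p ^ 4 * (3 / 2 : ℝ) ^ (7 * (d / 8)) := by rw [pow_add]; ring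
        _ ≤ 2 * (3 / 2 : ℝ) ^ 7 * (F.L : ℝ) ^ (3 * F.m) * (β ^ 4 * (((d / 8 : ℕ) : ℝ) + 1) ^ (4 * N)) * (3 / 2 : ℝ) ^ (7 * (d / 8)) := by
            gcongr
        _ = 2 * (3 / 2 : ℝ) ^ 7 * β ^ 4 * (F.L : ℝ) ^ (3 * F.m) * (((d / 8 : ℕ) : ℝ) + 1) ^ (4 * N) * (3 / 2 : ℝ) ^ (7 * (d / 8)) := by ring
        _ ≤ (F.L : ℝ) ^ (4 * (d / 8)) := h4'
    -- `(3/2)^s ≤ (3/2)^(7t+7)`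
    have h32s : (3 / 2 : ℝ) ^ (d - d / 8) ≤ (3 / 2 : ℝ) ^ (7 * (d / 8) + 7) := pow_le_pow_right₀ (by norm_num) hs7
    have hkey' : 2 * (3 / 2 : ℝ) ^ (d - d / 8) * p ^ 4 * (F.L : ℝ) ^ (3 * F.m) ≤ (F.L : ℝ) ^ (4 * (d / 8)) := by
      refine le_trans ?_ hkey
      have : 0 ≤ p ^ 4 * (F.L : ℝ) ^ (3 * F.m) := by positivity
      nlinarith [h32s, this]
    -- term (b): `p⁴·L^(3(m+d))·(3/2)^s/L^(4s) ≤ 1/2`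
    have hb : p ^ 4 * (F.L : ℝ) ^ (3 * (F.m + d)) * ((3 / 2 : ℝ) ^ (d - d / 8) / (F.L : ℝ) ^ (4 * (d - d / 8))) ≤ 1 / 2 := by
      rw [mul_div_assoc', div_le_iff₀ (by positivity)]
      have hexp : (F.L : ℝ) ^ (4 * (d / 8)) * (F.L : ℝ) ^ (3 * d) ≤ (F.L : ℝ) ^ (4 * (d - d / 8)) := by
        rw [← pow_add]
        exact pow_le_pow_right₀ hL1.le (by omega)
      calc p ^ 4 * (F.L : ℝ) ^ (3 * (F.m + d)) * (3 / 2 : ℝ) ^ (d - d / 8)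
          = 1 / 2 * ((2 * (3 / 2 : ℝ) ^ (d - d / 8) * p ^ 4 * (F.L : ℝ) ^ (3 * F.m)) * (F.L : ℝ) ^ (3 * d)) := by
            rw [mul_add, pow_add]; ring
        _ ≤ 1 / 2 * ((F.L : ℝ) ^ (4 * (d / 8)) * (F.L : ℝ) ^ (3 * d)) := by
            gcongr
        _ ≤ 1 / 2 * (F.L : ℝ) ^ (4 * (d - d / 8)) := by gcongr
    -- term (a): `p⁴·L^(3(m+d))·γ_d²·(3/2)^s/L^(2s) ≤ 1/2`
    have ha : p ^ 4 * (F.L : ℝ) ^ (3 * (F.m + d)) * ((γ * ((F.L : ℝ)⁻¹) ^ d) ^ 2 * (3 / 2 : ℝ) ^ (d - d / 8) / (F.L : ℝ) ^ (2 * (d - d / 8))) ≤ 1 / 2 := by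
      rw [mul_div_assoc', div_le_iff₀ (by positivity)]
      have hγ2 : γ ^ 2 ≤ 1 := pow_le_one₀ hγ.le hγ1
      have eL : (F.L : ℝ) ^ (3 * (F.m + d)) * ((γ * ((F.L : ℝ)⁻¹) ^ d) ^ 2) = γ ^ 2 * (F.L : ℝ) ^ (3 * F.m) * (F.L : ℝ) ^ d := by
        have hLd : (F.L : ℝ) ^ d ≠ 0 := by positivity
        rw [inv_pow]
        field_simp
        ring
      have hexp : (F.L : ℝ) ^ (4 * (d / 8)) * (F.L : ℝ) ^ d ≤ (F.L : ℝ) ^ (2 * (d - d / 8)) := by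
        rw [← pow_add]
        exact pow_le_pow_right₀ hL1.le (by omega)
      calc p ^ 4 * (F.L : ℝ) ^ (3 * (F.m + d)) * ((γ * ((F.L : ℝ)⁻¹) ^ d) ^ 2 * (3 / 2 : ℝ) ^ (d - d / 8))
          = p ^ 4 * ((F.L : ℝ) ^ (3 * (F.m + d)) * ((γ * ((F.L : ℝ)⁻¹) ^ d) ^ 2)) * (3 / 2 : ℝ) ^ (d - d / 8) := by ring
        _ = 1 / 2 * (γ ^ 2 * ((2 * (3 / 2 : ℝ) ^ (d - d / 8) * p ^ 4 * (F.L : ℝ) ^ (3 * F.m)) * (F.L : ℝ) ^ d)) := by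
            rw [eL]; ring
        _ ≤ 1 / 2 * (1 * ((F.L : ℝ) ^ (4 * (d / 8)) * (F.L : ℝ) ^ d)) := by
            gcongr
        _ ≤ 1 / 2 * (F.L : ℝ) ^ (2 * (d - d / 8)) := by rw [one_mul]; gcongr
    calc p ^ 4 * (F.L : ℝ) ^ (3 * (F.m + d)) *
          ((γ * ((F.L : ℝ)⁻¹) ^ d) ^ 2 * (3 / 2 : ℝ) ^ (d - d / 8) / (F.L : ℝ) ^ (2 * (d - d / 8)) +
            (3 / 2 : ℝ) ^ (d - d / 8) / (F.L : ℝ) ^ (4 * (d - d / 8)))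
        = p ^ 4 * (F.L : ℝ) ^ (3 * (F.m + d)) * ((γ * ((F.L : ℝ)⁻¹) ^ d) ^ 2 * (3 / 2 : ℝ) ^ (d - d / 8) / (F.L : ℝ) ^ (2 * (d - d / 8))) +
          p ^ 4 * (F.L : ℝ) ^ (3 * (F.m + d)) * ((3 / 2 : ℝ) ^ (d - d / 8) / (F.L : ℝ) ^ (4 * (d - d / 8))) := by ring
      _ ≤ 1 / 2 + 1 / 2 := add_le_add ha hb
      _ = 1 := by norm_num

end Summit.QuantumFields.YangMills.Theorems.RenyiTelescope

end
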